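import Summits.Ventures.PercRepro.RankLevelSetIndepSRI
import Summits.Ventures.PercRepro.RankLevelSetBiIndepLRSplit

/-! # RankLevelSetIndepCDSplit — THE EXACT SPLIT OF THE (CD) PROFILES AT A SECOND ELEMENT AND THE DOUBLE COUNTING
(night-1 g28; dossier §40)

For `e ∈ E` let `x_k = contractCount M e k` (independent `k`-sets `T ⊆ E ∖ {e}` with `T ∪ {e}` independent — the profile
of `M / e`) and `y_k = deleteCount M e k` (the profile of `M ∖ e`); (CD) (`IndepCD M`, `RankLevelSetIndepCD`) is the
TP2 property `x_{k+1} y_k ≤ x_k y_{k+1}`. For a second element `f ≠ e` write `I^A_k = sliceCount M e f A k`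
(`T ⊆ E ∖ {e, f}`, `#T = k`, `T ∪ A` independent, `A ⊆ {e, f}`; `RankLevelSetIndepSRI`). THIS MODULE:
* THE EXACT SPLITS `x_{k+1} = I^e_{k+1} + I^{ef}_k` and `y_{k+1} = I^∅_{k+1} + I^f_k` (`contractCount_split`,
  `deleteCount_split`: `T ∌ f` / `T ∋ f`, `T ↦ T ∖ {f}`);
* THE DOUBLE COUNTING `(k + 1) · x_{k+1} = Σ_{f ∈ E ∖ {e}} I^{ef}_k` and `(k + 1) · y_{k+1} = Σ_{f ∈ E ∖ {e}} I^f_k`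
  (`succ_mul_contractCount`, `succ_mul_deleteCount`; g24's `sum_ncard_filter_mem`), and `x_0 = I^e_0`, `y_0 = I^∅_0`;
These identities feed `RankLevelSetIndepCDCross` (the profiles of the minors `M / f`, `M ∖ f` as slices and the
inductive step of (CD) with its cross term) and `RankLevelSetIndepCDOfSRI` (the AVERAGED induction (SRI) ⟹ (CD)).
Nothing here asserts (CD); every declaration has a docstring; imports: the cell's own modules and Mathlib only.
Axioms: standard. -/

namespace PercRepro

open Set Matroid Finset

variable {α : Type} (M : Matroid α) [M.Finite]

/-! ## The families behind `contractCount` and `deleteCount` -/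

omit [M.Finite] in
/-- The family counted by `contractCount M e k`: `T ⊆ E ∖ {e}` with `#T = k` and `T ∪ {e}` independent. -/
def cdContractSets (e : α) (k : ℕ) : Set (Set α) :=
  {T : Set α | T ⊆ M.E \ {e} ∧ T.ncard = k ∧ M.Indep (insert e T)}

omit [M.Finite] in
/-- The family counted by `deleteCount M e k`: `T ⊆ E ∖ {e}` with `#T = k` and `T` independent. -/
def cdDeleteSets (e : α) (k : ℕ) : Set (Set α) :=
  {T : Set α | T ⊆ M.E \ {e} ∧ T.ncard = k ∧ M.Indep T}

omit [M.Finite] in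
/-- `contractCount` is the size of `cdContractSets`. -/
lemma contractCount_eq_ncard (e : α) (k : ℕ) : contractCount M e k = (cdContractSets M e k).ncard := rfl

omit [M.Finite] in
/-- `deleteCount` is the size of `cdDeleteSets`. -/
lemma deleteCount_eq_ncard (e : α) (k : ℕ) : deleteCount M e k = (cdDeleteSets M e k).ncard := rfl

/-- `cdContractSets` is finite (a family of subsets of the finite ground set). -/
lemma cdContractSets_finite (e : α) (k : ℕ) : (cdContractSets M e k).Finite :=
  (M.ground_finite.sdiff (t := {e})).finite_subsets.subset (fun _ hT => hT.1)

/-- `cdDeleteSets` is finite. -/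
lemma cdDeleteSets_finite (e : α) (k : ℕ) : (cdDeleteSets M e k).Finite :=
  (M.ground_finite.sdiff (t := {e})).finite_subsets.subset (fun _ hT => hT.1)

omit [M.Finite] in
/-- A finite family of sets splits by the membership of an element `f`. -/
lemma ncard_split_mem_elem (𝒟 : Set (Set α)) (h𝒟 : 𝒟.Finite) (f : α) :
    𝒟.ncard = {T ∈ 𝒟 | f ∈ T}.ncard + {T ∈ 𝒟 | f ∉ T}.ncard := by
  have h := ncard_filter_split_mem 𝒟 h𝒟 (fun _ => True) f
  simp only [true_and] at h
  have h0 : {T ∈ 𝒟 | True} = 𝒟 := by ext T; simp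
  rw [h0] at h
  exact h

/-! ## The splits at a second element `f` -/

omit [M.Finite] in
/-- The members of `cdContractSets M e (k+1)` containing `f ≠ e` correspond to the `(e, f)`-slice `I^{ef}_k`
(`T ↦ T ∖ {f}`). -/
lemma ncard_cdContractSets_mem [M.Finite] (e f : α) (hfe : f ≠ e) (k : ℕ) :
    {T ∈ cdContractSets M e (k + 1) | f ∈ T}.ncard = sliceCount M e f {e, f} k := by
  unfold cdContractSets sliceCount
  refine Set.ncard_congr (fun T _ => T \ {f}) ?_ ?_ ?_
  · rintro T ⟨⟨hTE, hTcard, hTind⟩, hfT⟩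
    refine ⟨?_, ?_, ?_⟩
    · intro x hx
      have hxE := hTE hx.1
      simp only [Set.mem_sdiff, Set.mem_singleton_iff, Set.mem_insert_iff] at hxE hx ⊢
      exact ⟨hxE.1, fun h => h.elim hxE.2 hx.2⟩
    · rw [Set.ncard_sdiff_singleton_of_mem hfT, hTcard]; rfl
    · have h1 : T \ {f} ∪ {e, f} = insert e T := by
        ext x
        simp only [Set.mem_union, Set.mem_sdiff, Set.mem_singleton_iff, Set.mem_insert_iff]
        constructor
        · rintro (⟨hx, -⟩ | hx | hx)
          · exact Or.inr hx
          · exact Or.inl hx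
          · exact Or.inr (hx ▸ hfT)
        · rintro (hx | hx)
          · exact Or.inr (Or.inl hx)
          · by_cases hxf : x = f
            · exact Or.inr (Or.inr hxf)
            · exact Or.inl ⟨hx, hxf⟩
      rw [h1]; exact hTind
  · rintro T T' ⟨-, hfT⟩ ⟨-, hfT'⟩ h
    rw [← Set.insert_sdiff_self_of_mem hfT, ← Set.insert_sdiff_self_of_mem hfT', h]
  · rintro T' ⟨hT'E, hT'card, hT'ind⟩
    have hfT' : f ∉ T' := fun h => (hT'E h).2 (by simp)
    have hfE : f ∈ M.E := hT'ind.subset_ground (by simp)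
    have hT'fin : T'.Finite := M.ground_finite.subset (hT'E.trans Set.sdiff_subset)
    refine ⟨insert f T', ⟨⟨?_, ?_, ?_⟩, Set.mem_insert f T'⟩, Set.insert_sdiff_self_of_notMem hfT'⟩
    · intro x hx
      rcases Set.mem_insert_iff.mp hx with rfl | hx
      · exact ⟨hfE, fun h => hfe (Set.mem_singleton_iff.mp h)⟩
      · have hxE := hT'E hx
        simp only [Set.mem_sdiff, Set.mem_singleton_iff, Set.mem_insert_iff] at hxE ⊢
        exact ⟨hxE.1, fun h => hxE.2 (Or.inl h)⟩
    · rw [Set.ncard_insert_of_notMem hfT' hT'fin, hT'card]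
    · have h1 : insert e (insert f T') = T' ∪ {e, f} := by
        ext x
        simp only [Set.mem_union, Set.mem_singleton_iff, Set.mem_insert_iff]
        tauto
      rw [h1]; exact hT'ind

omit [M.Finite] in
/-- The members of `cdContractSets M e k` avoiding `f` are the `(e, f)`-slice `I^e_k` (for `f = e` both sides are `x_k`). -/
lemma ncard_cdContractSets_notMem (e f : α) (k : ℕ) :
    {T ∈ cdContractSets M e k | f ∉ T}.ncard = sliceCount M e f {e} k := by
  unfold cdContractSets sliceCount
  congr 1
  ext T
  simp only [Set.mem_setOf_eq, Set.union_singleton]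
  constructor
  · rintro ⟨⟨hTE, hTcard, hTind⟩, hfT⟩
    refine ⟨?_, hTcard, hTind⟩
    intro x hx
    have hxE := hTE hx
    simp only [Set.mem_sdiff, Set.mem_singleton_iff, Set.mem_insert_iff] at hxE ⊢
    exact ⟨hxE.1, fun h => h.elim hxE.2 (fun h' => hfT (h' ▸ hx))⟩
  · rintro ⟨hTE, hTcard, hTind⟩
    refine ⟨⟨?_, hTcard, hTind⟩, fun hfT => (hTE hfT).2 (by simp)⟩
    intro x hx
    have hxE := hTE hx
    simp only [Set.mem_sdiff, Set.mem_singleton_iff, Set.mem_insert_iff] at hxE ⊢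
    exact ⟨hxE.1, fun h => hxE.2 (Or.inl h)⟩

omit [M.Finite] in
/-- The members of `cdDeleteSets M e (k+1)` containing `f ≠ e` correspond to the `(e, f)`-slice `I^f_k`
(`T ↦ T ∖ {f}`). -/
lemma ncard_cdDeleteSets_mem [M.Finite] (e f : α) (hfe : f ≠ e) (k : ℕ) :
    {T ∈ cdDeleteSets M e (k + 1) | f ∈ T}.ncard = sliceCount M e f {f} k := by
  unfold cdDeleteSets sliceCount
  refine Set.ncard_congr (fun T _ => T \ {f}) ?_ ?_ ?_
  · rintro T ⟨⟨hTE, hTcard, hTind⟩, hfT⟩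
    refine ⟨?_, ?_, ?_⟩
    · intro x hx
      have hxE := hTE hx.1
      simp only [Set.mem_sdiff, Set.mem_singleton_iff, Set.mem_insert_iff] at hxE hx ⊢
      exact ⟨hxE.1, fun h => h.elim hxE.2 hx.2⟩
    · rw [Set.ncard_sdiff_singleton_of_mem hfT, hTcard]; rfl
    · have h1 : T \ {f} ∪ {f} = T := by
        rw [Set.union_singleton, Set.insert_sdiff_self_of_mem hfT]
      rw [h1]; exact hTind
  · rintro T T' ⟨-, hfT⟩ ⟨-, hfT'⟩ h
    rw [← Set.insert_sdiff_self_of_mem hfT, ← Set.insert_sdiff_self_of_mem hfT', h]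
  · rintro T' ⟨hT'E, hT'card, hT'ind⟩
    have hfT' : f ∉ T' := fun h => (hT'E h).2 (by simp)
    have hfE : f ∈ M.E := hT'ind.subset_ground (by simp)
    have hT'fin : T'.Finite := M.ground_finite.subset (hT'E.trans Set.sdiff_subset)
    refine ⟨insert f T', ⟨⟨?_, ?_, ?_⟩, Set.mem_insert f T'⟩, Set.insert_sdiff_self_of_notMem hfT'⟩
    · intro x hx
      rcases Set.mem_insert_iff.mp hx with rfl | hx
      · exact ⟨hfE, fun h => hfe (Set.mem_singleton_iff.mp h)⟩
      · have hxE := hT'E hx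
        simp only [Set.mem_sdiff, Set.mem_singleton_iff, Set.mem_insert_iff] at hxE ⊢
        exact ⟨hxE.1, fun h => hxE.2 (Or.inl h)⟩
    · rw [Set.ncard_insert_of_notMem hfT' hT'fin, hT'card]
    · rw [← Set.union_singleton]; exact hT'ind

omit [M.Finite] in
/-- The members of `cdDeleteSets M e k` avoiding `f` are the `(e, f)`-slice `I^∅_k` (for `f = e` both sides are `y_k`). -/
lemma ncard_cdDeleteSets_notMem (e f : α) (k : ℕ) :
    {T ∈ cdDeleteSets M e k | f ∉ T}.ncard = sliceCount M e f ∅ k := by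
  unfold cdDeleteSets sliceCount
  congr 1
  ext T
  simp only [Set.mem_setOf_eq, Set.union_empty]
  constructor
  · rintro ⟨⟨hTE, hTcard, hTind⟩, hfT⟩
    refine ⟨?_, hTcard, hTind⟩
    intro x hx
    have hxE := hTE hx
    simp only [Set.mem_sdiff, Set.mem_singleton_iff, Set.mem_insert_iff] at hxE ⊢
    exact ⟨hxE.1, fun h => h.elim hxE.2 (fun h' => hfT (h' ▸ hx))⟩
  · rintro ⟨hTE, hTcard, hTind⟩
    refine ⟨⟨?_, hTcard, hTind⟩, fun hfT => (hTE hfT).2 (by simp)⟩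
    intro x hx
    have hxE := hTE hx
    simp only [Set.mem_sdiff, Set.mem_singleton_iff, Set.mem_insert_iff] at hxE ⊢
    exact ⟨hxE.1, fun h => hxE.2 (Or.inl h)⟩

/-- **The split of the contraction profile at `f ≠ e`**: `x_{k+1} = I^e_{k+1} + I^{ef}_k`. -/
lemma contractCount_split (e f : α) (hfe : f ≠ e) (k : ℕ) :
    contractCount M e (k + 1) = sliceCount M e f {e} (k + 1) + sliceCount M e f {e, f} k := by
  rw [contractCount_eq_ncard, ncard_split_mem_elem _ (cdContractSets_finite M e (k + 1)) f,
    ncard_cdContractSets_mem M e f hfe k, ncard_cdContractSets_notMem M e f (k + 1), add_comm]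

/-- **The split of the deletion profile at `f ≠ e`**: `y_{k+1} = I^∅_{k+1} + I^f_k`. -/
lemma deleteCount_split (e f : α) (hfe : f ≠ e) (k : ℕ) :
    deleteCount M e (k + 1) = sliceCount M e f ∅ (k + 1) + sliceCount M e f {f} k := by
  rw [deleteCount_eq_ncard, ncard_split_mem_elem _ (cdDeleteSets_finite M e (k + 1)) f,
    ncard_cdDeleteSets_mem M e f hfe k, ncard_cdDeleteSets_notMem M e f (k + 1), add_comm]

/-! ## The double counting `(k + 1) · x_{k+1} = Σ_{f ≠ e} I^{ef}_k`, `(k + 1) · y_{k+1} = Σ_{f ≠ e} I^f_k` -/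

/-- Every member of `cdContractSets M e (k+1)` is counted once by each of its `k + 1` elements. -/
lemma sum_ncard_cdContractSets_mem (e : α) (k : ℕ) :
    ∑ f ∈ M.ground_finite.toFinset, {T ∈ cdContractSets M e (k + 1) | f ∈ T}.ncard =
      (k + 1) * contractCount M e (k + 1) := by
  have hfin := cdContractSets_finite M e (k + 1)
  rw [sum_ncard_filter_mem M _ hfin (fun T hT => hT.1.trans Set.sdiff_subset)]
  rw [Finset.sum_const_nat (m := k + 1) (fun T hT => (hfin.mem_toFinset.mp hT).2.1)]
  rw [mul_comm, contractCount_eq_ncard, Set.ncard_eq_toFinset_card _ hfin]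

/-- Every member of `cdDeleteSets M e (k+1)` is counted once by each of its `k + 1` elements. -/
lemma sum_ncard_cdDeleteSets_mem (e : α) (k : ℕ) :
    ∑ f ∈ M.ground_finite.toFinset, {T ∈ cdDeleteSets M e (k + 1) | f ∈ T}.ncard =
      (k + 1) * deleteCount M e (k + 1) := by
  have hfin := cdDeleteSets_finite M e (k + 1)
  rw [sum_ncard_filter_mem M _ hfin (fun T hT => hT.1.trans Set.sdiff_subset)]
  rw [Finset.sum_const_nat (m := k + 1) (fun T hT => (hfin.mem_toFinset.mp hT).2.1)]
  rw [mul_comm, deleteCount_eq_ncard, Set.ncard_eq_toFinset_card _ hfin]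

omit [M.Finite] in
/-- No member of `cdContractSets M e k` contains `e`. -/
lemma ncard_cdContractSets_mem_self (e : α) (k : ℕ) : {T ∈ cdContractSets M e k | e ∈ T}.ncard = 0 := by
  have h : {T ∈ cdContractSets M e k | e ∈ T} = (∅ : Set (Set α)) := by
    ext T
    simp only [Set.mem_setOf_eq, Set.mem_empty_iff_false, iff_false, not_and]
    exact fun hT heT => (hT.1 heT).2 rfl
  rw [h, Set.ncard_empty]

omit [M.Finite] in
/-- No member of `cdDeleteSets M e k` contains `e`. -/
lemma ncard_cdDeleteSets_mem_self (e : α) (k : ℕ) : {T ∈ cdDeleteSets M e k | e ∈ T}.ncard = 0 := by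
  have h : {T ∈ cdDeleteSets M e k | e ∈ T} = (∅ : Set (Set α)) := by
    ext T
    simp only [Set.mem_setOf_eq, Set.mem_empty_iff_false, iff_false, not_and]
    exact fun hT heT => (hT.1 heT).2 rfl
  rw [h, Set.ncard_empty]

/-- **Double counting the contraction profile**: `(k + 1) · x_{k+1} = Σ_{f ∈ E ∖ {e}} I^{ef}_k`. -/
lemma succ_mul_contractCount [DecidableEq α] {e : α} (he : e ∈ M.E) (k : ℕ) :
    (k + 1) * contractCount M e (k + 1) = ∑ f ∈ M.ground_finite.toFinset.erase e, sliceCount M e f {e, f} k := by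
  rw [← sum_ncard_cdContractSets_mem, ← Finset.add_sum_erase _ _ (M.ground_finite.mem_toFinset.mpr he),
    ncard_cdContractSets_mem_self, zero_add]
  refine Finset.sum_congr rfl (fun f hf => ?_)
  exact ncard_cdContractSets_mem M e f (Finset.mem_erase.mp hf).1 k

/-- **Double counting the deletion profile**: `(k + 1) · y_{k+1} = Σ_{f ∈ E ∖ {e}} I^f_k`. -/
lemma succ_mul_deleteCount [DecidableEq α] {e : α} (he : e ∈ M.E) (k : ℕ) :
    (k + 1) * deleteCount M e (k + 1) = ∑ f ∈ M.ground_finite.toFinset.erase e, sliceCount M e f {f} k := by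
  rw [← sum_ncard_cdDeleteSets_mem, ← Finset.add_sum_erase _ _ (M.ground_finite.mem_toFinset.mpr he),
    ncard_cdDeleteSets_mem_self, zero_add]
  refine Finset.sum_congr rfl (fun f hf => ?_)
  exact ncard_cdDeleteSets_mem M e f (Finset.mem_erase.mp hf).1 k

/-! ## Level `0`: `x_0` and `y_0` are the level-`0` slices at any `f` -/

/-- `x_0 = I^e_0` at every `f`: both count the empty set iff `e` is not a loop. -/
lemma contractCount_zero_eq_slice (e f : α) : contractCount M e 0 = sliceCount M e f {e} 0 := by
  unfold contractCount sliceCount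
  congr 1
  ext T
  simp only [Set.mem_setOf_eq, Set.union_singleton]
  constructor
  · rintro ⟨hTE, hT0, hTind⟩
    have hTfin : T.Finite := M.ground_finite.subset (hTE.trans Set.sdiff_subset)
    rw [Set.ncard_eq_zero hTfin] at hT0
    subst hT0
    exact ⟨Set.empty_subset _, Set.ncard_empty _, hTind⟩
  · rintro ⟨hTE, hT0, hTind⟩
    have hTfin : T.Finite := M.ground_finite.subset (hTE.trans Set.sdiff_subset)
    rw [Set.ncard_eq_zero hTfin] at hT0
    subst hT0
    exact ⟨Set.empty_subset _, Set.ncard_empty _, hTind⟩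

/-- `y_0 = I^∅_0` at every `f`: both count the empty set. -/
lemma deleteCount_zero_eq_slice (e f : α) : deleteCount M e 0 = sliceCount M e f ∅ 0 := by
  unfold deleteCount sliceCount
  congr 1
  ext T
  simp only [Set.mem_setOf_eq, Set.union_empty]
  constructor
  · rintro ⟨hTE, hT0, hTind⟩
    have hTfin : T.Finite := M.ground_finite.subset (hTE.trans Set.sdiff_subset)
    rw [Set.ncard_eq_zero hTfin] at hT0
    subst hT0
    exact ⟨Set.empty_subset _, Set.ncard_empty _, hTind⟩
  · rintro ⟨hTE, hT0, hTind⟩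
    have hTfin : T.Finite := M.ground_finite.subset (hTE.trans Set.sdiff_subset)
    rw [Set.ncard_eq_zero hTfin] at hT0
    subst hT0
    exact ⟨Set.empty_subset _, Set.ncard_empty _, hTind⟩

end PercRepro
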